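import Literature.AlgebraicGeometry.AbelianSchemes.RoofFlatComparisonLeg             -- ★ (H4′-φ♭) A: `φ♭`, its rows and its kernel on the two blocks
import Literature.AlgebraicGeometry.AbelianSchemes.RoofImageLineCount                -- ★ (J1): `map_pt_one'∕mul'∕inv'` (points of a homomorphism)
import Literature.AlgebraicGeometry.AbelianSchemes.IdealTorsionPointsCoprimeSplitting -- ★ `RingAction.natCard_eq_mul_of_idealTorsion_mul` (CRT splitting of the count)
import HarnessLib

/-!
# The comparison leg `φ♭` of two `p`-isogeny roofs — the COUNT `#Ker φ♭(Ω) = n·n` and the consumer-shaped package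
# ([MumfordAV1970] §7 Thm. 4, §15 Thm. 1, §23; [Liu2021] Prop. D.8 (2)(3))

Topic `AlgebraicGeometry/AbelianSchemes`, namespace `Literature.AlgebraicGeometry.AbelianSchemes.AbelianSchemeOver` (sequel to ★ `RoofFlatComparisonLeg`).  THEOREMS
ONLY (no definition, no named fact, no `instance`, no notation, no `sorry`).  Cell `hodgecm-mathlib` (D-0151), F0∕P6 «MOD», line L2 (socket `stub_DOWN`, D6 road), organ
**(H4′-φ♭) «THE COMPARISON LEG»** (LA2-plan (g2) 2026-09-02T09:18:21Z (ii), 09:28:58Z (1)).  `--supports stmt-HodgeConjecture-24832`, count-neutral.  HONEST LABEL: HC_CM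
is proved only modulo the cell's 2 remaining named inputs (hLiu418 24832, h413 24833) until rung 0 closes; this file is generic and discharges none of them.

## Mathematics (`Ω = Ω̄` of characteristic `0`; notation of ★ `RoofFlatComparisonLeg`)

* §1 **THE `𝔭`-BLOCK COUNT `#W · #K_𝔭 = #A[𝔭]`** for `W := {x^p | c x ∈ q(A[𝔭])} ⊆ A″(Ω)` and `K_𝔭 := K ∩ A[𝔭]` (`K = Ker q(Ω)`): with the return hom `d` of the
  COVER (`c ≫ d = [p]`, `d ≫ c = [p]`; `Ker c ⊆ A″[p]` as `p ∈ 𝔭`), `W = u(A[𝔭])` for the homomorphism `u := q ≫ d` (`x^p = d(c x) = d(q R) = u R`, and `c` is onto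
  on points), and `Ker (u|A[𝔭]) = K_𝔭`: if `u R = 1` write `q R = c x′` (`x′^p = d(q R) = 1`), split `x′ = ι″(1−ε)x′ · ι″(ε)x′` with the CRT element
  `ε ≡ 1 (𝔭)`, `ε𝔭 ⊆ (p)`; then `ι″(ε)x′ ∈ A″[𝔭] = Ker c` and `c(ι″(1−ε)x′) = b_{1−ε}(q R) = q(ι(1−ε)R) = 1`, so `q R = c x′ = 1`.  Mathlib's
  `Subgroup.card_mul_index`∕`index_ker` finish.  (Lattices: `W = T_w ∕ ϖ(T_w + K̃_w)`, of order `[T_w : ϖT_w] ∕ #K_w = q²∕q`.)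
* §2 **THE PACKAGE `exists_flatLeg_of_roofs`** — consumer-shaped (rows in the token shapes of the P6a letter `RoofΩ`, as ★ (ρ2″)∕(C5a)): from roof₁ `A —q→ B ←c— A″`
  (its (r1)–(r5), `K ⊆ A[𝔭𝔭′]`), roof₀ `A —q₀→ B₂ ←c₀— A_t` (its (r1) `Ker q₀ = A[𝔭′]`, (r3₀), (r4₀), (r5₀)), the CRT data at `𝔭`, `𝔭′` and the three numbers
  `#A[𝔭] = n·n`, `#K_𝔭 = n`, `#L♯ = n` (`L♯` = the image line `{x ∈ A″[𝔭′] | c x ∈ q(A[𝔭′])}`): THERE IS a homomorphism `φ♭ : A″ → B₂` with kernel `K♭ ≤ A″(Ω)` such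
  that (r1♭) `Ker φ♭(Ω) = K♭`, (r3♭) `φ♭ ≫ λ_{B₂} ≫ φ♭^∨ = λ″ ≫ [p]`, (r4♭) `ι″(a) ≫ φ♭ = φ♭ ≫ b⁰_a`, `ι_t(a) ≫ c₀ = c₀ ≫ b⁰_a`, (r5♭) `φ♭(σ″ᵢ) = c₀(σᵗᵢ)`;
  `K♭ ⊆ A″[𝔭𝔭′]` is `ι″`-stable; (V♭) `K♭ ∩ A″[𝔭′] = L♯`; (W♭) `K♭ ∩ A″[𝔭] = W`; and (COUNT) `#K♭ = n·n` (CRT splitting ★ `natCard_eq_mul_of_idealTorsion_mul`, §1,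
  `#L♯ = n`).  In [Liu2021] Prop. D.8 this is the roof realising `t₁(w̄)` at `(y″, L♯)` landing on the central translate `⟨ϖ⟩y`.

## References
* [MumfordAV1970] D. Mumford, *Abelian Varieties* (1970), §7 Thm. 4 (p. 72), §15 Thm. 1 (p. 143), §19 Thm. 3 (p. 176), §23 Thm. 2 (p. 231).
* [Liu2021] Y. Liu, *Fourier–Jacobi cycles and arithmetic relative trace formula*, Camb. J. Math. 9 (2021), App. D, Prop. D.8 (2)(3) (p. 135), pp. 136–138.
* [AtiyahMacdonald1969] M. Atiyah, I. Macdonald, *Introduction to Commutative Algebra* (1969), Prop. 1.10.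
* [MumfordFogartyKirwan1994] D. Mumford, J. Fogarty, F. Kirwan, *Geometric Invariant Theory* (1994), Ch. 7 §2 Definition 7.1 (p. 129).
-/

set_option autoImplicit false

noncomputable section

set_option backward.isDefEq.respectTransparency false

open CategoryTheory CategoryTheory.Limits AlgebraicGeometry MonoidalCategory CartesianMonoidalCategory
open scoped MonObj CategoryTheory.Obj Pointwise
open Literature.AlgebraicGeometry.Motives (AlgPoints SchemeOver specOver)

namespace Literature.AlgebraicGeometry.AbelianSchemes

namespace AbelianSchemeOver

variable {O : Type*} [CommRing O] {Ω : Type} [Field Ω] [IsAlgClosed Ω] [CharZero Ω]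
  {A A'' At B B₂ : AbelianSchemeOver (Spec (.of Ω))}
  (act : A.RingAction O) (act'' : A''.RingAction O) (actt : At.RingAction O)
  (q : A.X ⟶ B.X) [IsMonHom q] (c : A''.X ⟶ B.X) [IsMonHom c]
  (q₀ : A.X ⟶ B₂.X) [IsMonHom q₀] (c₀ : At.X ⟶ B₂.X) [IsMonHom c₀]

/-! ## §1 The `𝔭`-block count `#W · #K_𝔭 = #A[𝔭]` -/

set_option maxHeartbeats 400000 in
/-- **`#W · #(K ∩ A[𝔭]) = #A[𝔭]`** for `W = {x^p | c x = q R, R ∈ A[𝔭]} ⊆ A″(Ω)` (the `𝔭`-block of `Ker φ♭`, ★ `exists_pow_eq_of_map_flatLeg_eq_one`∕`map_flatLeg_pow_eq_one`)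
and `K = Ker q(Ω)`: `W` is the image of `A[𝔭]` under the homomorphism `u = q ≫ d` (`d` the return hom of the cover, `c ≫ d = [p]`; `c` onto on points), whose kernel on
`A[𝔭]` is `K ∩ A[𝔭]` (CRT element `ε ≡ 1 (𝔭)`, `ε𝔭 ⊆ (p)`: `u R = 1`, `q R = c x′` ⟹ `x′ ∈ A″[p]`, `c x′ = c(ι″(1−ε)x′)·c(ι″(ε)x′) = q(ι(1−ε)R)·1 = 1`).
[cite: Liu2021, Prop. D.8 (2)(3) p. 135, pp. 136–138] [cite: MumfordAV1970, §7 Thm. 4 (p. 72)] -/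
theorem natCard_wBlock_mul_natCard_eq [IsFinite c.left] {p : ℕ} (𝔭 : Ideal O) (hp𝔭 : (p : O) ∈ 𝔭)
    (ε : O) (hε1 : ε - 1 ∈ 𝔭) (hε2 : ∀ α ∈ 𝔭, α * ε ∈ Ideal.span {(p : O)})
    (K : Subgroup (A.toAffine.toAbelianVariety.Points Ω))
    (h1 : ∀ P : A.toAffine.toAbelianVariety.Points Ω, (AlgPoints.map q P : B.toAffine.toAbelianVariety.Points Ω) = 1 ↔ P ∈ K)
    (h2 : ∀ P : A''.toAffine.toAbelianVariety.Points Ω,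
      (AlgPoints.map c P : B.toAffine.toAbelianVariety.Points Ω) = 1 ↔
        ∀ a ∈ 𝔭, (AlgPoints.map (act''.i a) P : A''.toAffine.toAbelianVariety.Points Ω) = 1)
    (h2s : Function.Surjective c.left.base)
    (h4 : ∀ a : O, ∃ b : B.X ⟶ B.X, act.i a ≫ q = q ≫ b ∧ act''.i a ≫ c = c ≫ b) :
    Nat.card {P'' : A''.toAffine.toAbelianVariety.Points Ω //
        ∃ R : A.toAffine.toAbelianVariety.Points Ω, (∀ a ∈ 𝔭, (AlgPoints.map (act.i a) R : A.toAffine.toAbelianVariety.Points Ω) = 1) ∧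
          ∃ x : A''.toAffine.toAbelianVariety.Points Ω,
            (AlgPoints.map c x : B.toAffine.toAbelianVariety.Points Ω) = AlgPoints.map q R ∧ P'' = x ^ p} *
      Nat.card {P : A.toAffine.toAbelianVariety.Points Ω //
        P ∈ K ∧ ∀ a ∈ 𝔭, (AlgPoints.map (act.i a) P : A.toAffine.toAbelianVariety.Points Ω) = 1} =
      Nat.card {P : A.toAffine.toAbelianVariety.Points Ω // ∀ a ∈ 𝔭, (AlgPoints.map (act.i a) P : A.toAffine.toAbelianVariety.Points Ω) = 1} := by
  classical
  haveI := act.isMonHom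
  haveI := act''.isMonHom
  haveI : IsCommMonObj A.X := A.isCommMonObj_of_isReduced_base
  haveI : IsCommMonObj A''.X := A''.isCommMonObj_of_isReduced_base
  haveI : IsCommMonObj B.X := B.isCommMonObj_of_isReduced_base
  haveI : IsMonHom (A''.mulN p) := A''.isMonHom_mulN p
  haveI : IsMonHom (B.mulN p) := B.isMonHom_mulN p
  haveI : Surjective c.left := ⟨h2s⟩
  haveI : LocallyOfFiniteType A''.X.hom := (inferInstance : LocallyOfFiniteType A''.toAffine.toAbelianVariety.X.hom)
  -- the return hom `d` of the cover: `Ker c = A″[𝔭] ⊆ A″[p]`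
  have hcp : ∀ P : specOver Ω Ω ⟶ A''.X, P ≫ c = 1 → P ^ p = 1 := fun P hP => by
    have h := (h2 P).1 hP (p : O) hp𝔭
    rw [AlgPoints.map_apply, comp_i_natCast] at h
    exact h
  obtain ⟨d, hd, hcd, -⟩ := exists_returnHom_quotient c hcp
  haveI := hd
  -- `T := A[𝔭] ≤ A(Ω)` and `u := (q ≫ d)|_T`
  let T : Subgroup (A.toAffine.toAbelianVariety.Points Ω) :=
    { carrier := {P | ∀ a ∈ 𝔭, (AlgPoints.map (act.i a) P : A.toAffine.toAbelianVariety.Points Ω) = 1}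
      one_mem' := fun a _ => by haveI := act.isMonHom a; exact map_pt_one' _
      mul_mem' := fun {P Q} hP hQ a ha => by haveI := act.isMonHom a; rw [map_pt_mul', hP a ha, hQ a ha, mul_one]
      inv_mem' := fun {P} hP a ha => by haveI := act.isMonHom a; rw [map_pt_inv', hP a ha, inv_one] }
  have hTmem : ∀ P, P ∈ T ↔ ∀ a ∈ 𝔭, (AlgPoints.map (act.i a) P : A.toAffine.toAbelianVariety.Points Ω) = 1 := fun P => Iff.rfl
  let u : ↥T →* A''.toAffine.toAbelianVariety.Points Ω := (IsMonHom.monoidHom (q ≫ d) (specOver Ω Ω)).restrict T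
  have hu : ∀ P : ↥T, u P = ((P : A.toAffine.toAbelianVariety.Points Ω) : specOver Ω Ω ⟶ A.X) ≫ q ≫ d := fun P => rfl
  have h1ε : 1 - ε ∈ 𝔭 := by
    have e : 1 - ε = -(ε - 1) := by ring
    rw [e]; exact 𝔭.neg_mem hε1
  have hmulN : ∀ x : specOver Ω Ω ⟶ A''.X, x ≫ A''.mulN p = x ^ p := fun x => by rw [mulN_def, MonObj.comp_pow, Category.comp_id]
  -- `Ker u = K ∩ A[𝔭]`
  have hker : ∀ R : ↥T, u R = 1 ↔ (R : A.toAffine.toAbelianVariety.Points Ω) ∈ K := by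
    intro R
    rw [hu, ← h1, AlgPoints.map_apply]
    constructor
    · intro hRu
      obtain ⟨x', hx'⟩ := AlgPoints.map_surjective_of_surjective_of_isAlgClosed' (L := Ω) c
        (AlgPoints.map q (R : A.toAffine.toAbelianVariety.Points Ω))
      rw [AlgPoints.map_apply, AlgPoints.map_apply] at hx'
      -- `x′ ∈ A″[p]`
      have hx'p : x' ^ p = 1 := by
        calc x' ^ p = x' ≫ A''.mulN p := by rw [mulN_def, MonObj.comp_pow, Category.comp_id]
          _ = (x' ≫ c) ≫ d := by rw [Category.assoc, hcd]
          _ = 1 := by rw [hx', Category.assoc]; exact hRu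
      -- `c(ι″(ε) x′) = 1`
      have hε' : (x' ≫ act''.i ε) ≫ c = 1 := by
        refine (h2 _).2 fun α hα => ?_
        obtain ⟨r, hr⟩ := Ideal.mem_span_singleton'.mp (hε2 α hα)
        rw [AlgPoints.map_apply, Category.assoc, ← act''.i_mul, ← hr, act''.comp_i_mul, comp_i_natCast act'' x' p, hx'p, MonObj.one_comp]
      -- `c(ι″(1−ε) x′) = q(ι(1−ε) R) = 1`
      have h1ε' : (x' ≫ act''.i (1 - ε)) ≫ c = 1 := by
        obtain ⟨b, hbq, hbc⟩ := h4 (1 - ε)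
        have hR := R.2 (1 - ε) h1ε
        rw [AlgPoints.map_apply] at hR
        rw [Category.assoc, hbc, ← Category.assoc, hx', Category.assoc, ← hbq, ← Category.assoc, hR, MonObj.one_comp]
      have hsplit : x' = (x' ≫ act''.i (1 - ε)) * (x' ≫ act''.i ε) := by
        rw [← act''.comp_i_add, sub_add_cancel]; exact (act''.comp_i_zero_one x').2.symm
      rw [← hx', hsplit, MonObj.mul_comp, hε', h1ε', mul_one]
    · intro hRq
      rw [← Category.assoc, hRq, MonObj.one_comp]
  have eker : ↥u.ker ≃ {P : A.toAffine.toAbelianVariety.Points Ω //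
      P ∈ K ∧ ∀ a ∈ 𝔭, (AlgPoints.map (act.i a) P : A.toAffine.toAbelianVariety.Points Ω) = 1} :=
    { toFun := fun R => ⟨(R.1 : A.toAffine.toAbelianVariety.Points Ω), (hker R.1).1 R.2, R.1.2⟩
      invFun := fun P => ⟨⟨P.1, P.2.2⟩, (hker _).2 P.2.1⟩
      left_inv := fun _ => rfl
      right_inv := fun _ => rfl }
  -- `W = u(A[𝔭])`
  have hW : ∀ P'' : A''.toAffine.toAbelianVariety.Points Ω,
      (∃ R : A.toAffine.toAbelianVariety.Points Ω, (∀ a ∈ 𝔭, (AlgPoints.map (act.i a) R : A.toAffine.toAbelianVariety.Points Ω) = 1) ∧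
          ∃ x : A''.toAffine.toAbelianVariety.Points Ω,
            (AlgPoints.map c x : B.toAffine.toAbelianVariety.Points Ω) = AlgPoints.map q R ∧ P'' = x ^ p) ↔ P'' ∈ u.range := by
    intro P''
    rw [MonoidHom.mem_range]
    constructor
    · rintro ⟨R, hR, x, hcx, rfl⟩
      refine ⟨⟨R, hR⟩, ?_⟩
      rw [AlgPoints.map_apply, AlgPoints.map_apply] at hcx
      rw [hu]
      calc ((R : A.toAffine.toAbelianVariety.Points Ω) : specOver Ω Ω ⟶ A.X) ≫ q ≫ d = (x ≫ c) ≫ d := by rw [hcx, Category.assoc]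
        _ = x ^ p := by rw [Category.assoc, hcd]; exact hmulN x
    · rintro ⟨R, hR⟩
      obtain ⟨x, hx⟩ := AlgPoints.map_surjective_of_surjective_of_isAlgClosed' (L := Ω) c
        (AlgPoints.map q (R : A.toAffine.toAbelianVariety.Points Ω))
      refine ⟨R, R.2, x, hx, ?_⟩
      rw [AlgPoints.map_apply, AlgPoints.map_apply] at hx
      rw [← hR, hu]
      calc ((R : A.toAffine.toAbelianVariety.Points Ω) : specOver Ω Ω ⟶ A.X) ≫ q ≫ d = (x ≫ c) ≫ d := by rw [hx, Category.assoc]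
        _ = x ^ p := by rw [Category.assoc, hcd]; exact hmulN x
  -- count
  have hT : Nat.card ↥T = Nat.card {P : A.toAffine.toAbelianVariety.Points Ω //
      ∀ a ∈ 𝔭, (AlgPoints.map (act.i a) P : A.toAffine.toAbelianVariety.Points Ω) = 1} := rfl
  rw [← hT, ← Subgroup.card_mul_index u.ker, Subgroup.index_ker, Nat.card_congr eker, Nat.card_congr (Equiv.subtypeEquivRight hW), mul_comm]

/-! ## §2 The package: the comparison roof `(φ♭, c₀)` at `A″` landing on `A_t`, with its kernel read on both blocks and counted -/

set_option maxHeartbeats 400000 in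
/-- **THE COMPARISON ROOF `A″ —φ♭→ B₂ ←c₀— A_t` AND ITS KERNEL** (consumer-shaped; rows in the token shapes of the P6a letter `RoofΩ`).  INPUT: roof₁ `A —q→ B ←c— A″`
((r1) `Ker q(Ω) = K` with `K ⊆ A[𝔭𝔭′]`, (r2) `Ker c(Ω) = A″[𝔭]`, `c` onto, (r3), (r4), (r5) on `N`-torsion families), roof₀ `A —q₀→ B₂ ←c₀— A_t` ((r1₀) `Ker q₀(Ω) = A[𝔭′]`,
(r3₀) for `q₀`, (r4₀), (r5₀)), both legs `q`, `q₀` finite surjective and `c` finite; ideals `𝔭 + 𝔭′ = (1)` containing `p ≠ 0`, a CRT element `ε` (`ε ≡ 1 (𝔭)`, `ε𝔭 ⊆ (p)`,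
`ε ∈ 𝔭′`), `𝔭′ ⊆ 𝔭′² + (p)`, `p·m ≡ 1 (N)`; the numbers `#A[𝔭] = n·n`, `#(K ∩ A[𝔭]) = n`, `#L♯ = n` for a subgroup `L♯` with the image-line membership.  OUTPUT: a
homomorphism `φ♭ : A″ → B₂` and `K♭ ≤ A″(Ω)` with (r1♭) `φ♭ P = 1 ↔ P ∈ K♭`; (r3♭) `φ♭ ≫ λ_{B₂} ≫ φ♭^∨ = λ″ ≫ [p]`; (r4♭) common intertwiners `b⁰_a` with `c₀`; (r5♭)
`φ♭(σ″ᵢ) = c₀(σᵗᵢ)`; `K♭ ⊆ A″[𝔭𝔭′]`, `ι″`-stable; (V♭) `K♭ ∩ A″[𝔭′] = L♯` (membership form); (W♭) `K♭ ∩ A″[𝔭] = {x^p | c x ∈ q(A[𝔭])}`; (COUNT) `#K♭ = n·n`.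
[cite: Liu2021, Prop. D.8 (2)(3) p. 135, pp. 136–138] [cite: MumfordAV1970, §7 Thm. 4 (p. 72), §15 Thm. 1 (p. 143), §23 Thm. 2 (p. 231)]
[cite: AtiyahMacdonald1969, Prop. 1.10] [cite: MumfordFogartyKirwan1994, Ch. 7 §2 Definition 7.1 (p. 129)] -/
theorem exists_flatLeg_of_roofs [IsFinite q.left] [Surjective q.left] [IsFinite c.left] [IsFinite q₀.left] [Surjective q₀.left]
    -- the ideals, the prime, the CRT data
    (𝔭 𝔭' : Ideal O) (h𝔭𝔭' : 𝔭 ⊔ 𝔭' = ⊤) {p : ℕ} (hp : p ≠ 0) (hp𝔭 : (p : O) ∈ 𝔭) (hp𝔭' : (p : O) ∈ 𝔭')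
    (h𝔭'unr : 𝔭' ≤ 𝔭' ^ 2 ⊔ Ideal.span {(p : O)})
    (ε : O) (hε1 : ε - 1 ∈ 𝔭) (hε2 : ∀ α ∈ 𝔭, α * ε ∈ Ideal.span {(p : O)}) (hε3 : ε ∈ 𝔭')
    -- dual pairs, polarisations, the two middle objects' data
    (D : A.DualPair) (pol : A.Polarization D) (D'' : A''.DualPair) (pol'' : A''.Polarization D'')
    (DB : B.DualPair) (lamB : B.X ⟶ DB.hat.X) [IsMonHom lamB]
    (hDB : Nonempty ((Scheme.Modules.pullback DB.unitHatSlice).obj DB.P ≅ SheafOfModules.unit _))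
    (DB₂ : B₂.DualPair) (lamB₂ : B₂.X ⟶ DB₂.hat.X) [IsMonHom lamB₂]
    (hDB₂ : Nonempty ((Scheme.Modules.pullback DB₂.unitHatSlice).obj DB₂.P ≅ SheafOfModules.unit _))
    -- roof₁ : (r1) + `K ⊆ A[𝔭𝔭′]`, (r2), (r3), (r4)
    (K : Subgroup (A.toAffine.toAbelianVariety.Points Ω))
    (hK : ∀ P ∈ K, ∀ a ∈ 𝔭 * 𝔭', (AlgPoints.map (act.i a) P : A.toAffine.toAbelianVariety.Points Ω) = 1)
    (h1 : ∀ P : A.toAffine.toAbelianVariety.Points Ω, (AlgPoints.map q P : B.toAffine.toAbelianVariety.Points Ω) = 1 ↔ P ∈ K)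
    (h2 : ∀ P : A''.toAffine.toAbelianVariety.Points Ω,
      (AlgPoints.map c P : B.toAffine.toAbelianVariety.Points Ω) = 1 ↔
        ∀ a ∈ 𝔭, (AlgPoints.map (act''.i a) P : A''.toAffine.toAbelianVariety.Points Ω) = 1)
    (h2s : Function.Surjective c.left.base)
    (h3 : q ≫ lamB ≫ DualPair.dualIsogenyOver q D DB = pol.lam ≫ D.hat.mulN p)
    (h3'' : c ≫ lamB ≫ DualPair.dualIsogenyOver c D'' DB = pol''.lam ≫ D''.hat.mulN p)
    (h4 : ∀ a : O, ∃ b : B.X ⟶ B.X, act.i a ≫ q = q ≫ b ∧ act''.i a ≫ c = c ≫ b)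
    -- roof₀ : (r1₀) `Ker q₀ = A[𝔭′]`, (r3₀) for `q₀`, (r4₀)
    (h1₀ : ∀ P : A.toAffine.toAbelianVariety.Points Ω,
      (AlgPoints.map q₀ P : B₂.toAffine.toAbelianVariety.Points Ω) = 1 ↔
        ∀ a ∈ 𝔭', (AlgPoints.map (act.i a) P : A.toAffine.toAbelianVariety.Points Ω) = 1)
    (h3₀ : q₀ ≫ lamB₂ ≫ DualPair.dualIsogenyOver q₀ D DB₂ = pol.lam ≫ D.hat.mulN p)
    (h4₀ : ∀ a : O, ∃ b₀ : B₂.X ⟶ B₂.X, act.i a ≫ q₀ = q₀ ≫ b₀ ∧ actt.i a ≫ c₀ = c₀ ≫ b₀)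
    -- (r5), (r5₀): `N`-torsion families of points and `p·m ≡ 1 (N)`
    {J : Type*} (σ : J → A.toAffine.toAbelianVariety.Points Ω) (σ'' : J → A''.toAffine.toAbelianVariety.Points Ω)
    (σt : J → At.toAffine.toAbelianVariety.Points Ω)
    (h5 : ∀ i, (AlgPoints.map q (σ i) : B.toAffine.toAbelianVariety.Points Ω) = AlgPoints.map c (σ'' i))
    (h5₀ : ∀ i, (AlgPoints.map q₀ (σ i) : B₂.toAffine.toAbelianVariety.Points Ω) = AlgPoints.map c₀ (σt i))
    {N : ℕ} (hσ'' : ∀ i, σ'' i ^ N = 1) (hσt : ∀ i, σt i ^ N = 1) (m : ℕ) (hm : p * m ≡ 1 [MOD N])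
    -- the three numbers
    {n : ℕ} (hn : 0 < n)
    (hA𝔭 : Nat.card {P : A.toAffine.toAbelianVariety.Points Ω //
      ∀ a ∈ 𝔭, (AlgPoints.map (act.i a) P : A.toAffine.toAbelianVariety.Points Ω) = 1} = n * n)
    (hK𝔭 : Nat.card {P : A.toAffine.toAbelianVariety.Points Ω //
      P ∈ K ∧ ∀ a ∈ 𝔭, (AlgPoints.map (act.i a) P : A.toAffine.toAbelianVariety.Points Ω) = 1} = n)
    (Lsharp : Subgroup (A''.toAffine.toAbelianVariety.Points Ω))
    (hLsharp : ∀ P'', P'' ∈ Lsharp ↔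
      (∀ a ∈ 𝔭', (AlgPoints.map (act''.i a) P'' : A''.toAffine.toAbelianVariety.Points Ω) = 1) ∧
        ∃ P : A.toAffine.toAbelianVariety.Points Ω, (∀ a ∈ 𝔭', (AlgPoints.map (act.i a) P : A.toAffine.toAbelianVariety.Points Ω) = 1) ∧
          (AlgPoints.map c P'' : B.toAffine.toAbelianVariety.Points Ω) = AlgPoints.map q P)
    (hcardL : Nat.card ↥Lsharp = n) :
    ∃ (φ : A''.X ⟶ B₂.X) (_ : IsMonHom φ) (Kflat : Subgroup (A''.toAffine.toAbelianVariety.Points Ω)),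
      -- (r1♭) kernel of `φ♭` on `Ω`-points
      (∀ P : A''.toAffine.toAbelianVariety.Points Ω, (AlgPoints.map φ P : B₂.toAffine.toAbelianVariety.Points Ω) = 1 ↔ P ∈ Kflat) ∧
      -- (r3♭) similitude
      φ ≫ lamB₂ ≫ DualPair.dualIsogenyOver φ D'' DB₂ = pol''.lam ≫ D''.hat.mulN p ∧
      -- (r4♭) common intertwiners with `c₀`
      (∀ a : O, ∃ b₀ : B₂.X ⟶ B₂.X, act''.i a ≫ φ = φ ≫ b₀ ∧ actt.i a ≫ c₀ = c₀ ≫ b₀) ∧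
      -- (r5♭) level points
      (∀ i, (AlgPoints.map φ (σ'' i) : B₂.toAffine.toAbelianVariety.Points Ω) = AlgPoints.map c₀ (σt i)) ∧
      -- `K♭ ⊆ A″[𝔭𝔭′]`, `ι″`-stable
      (∀ P ∈ Kflat, ∀ a ∈ 𝔭 * 𝔭', (AlgPoints.map (act''.i a) P : A''.toAffine.toAbelianVariety.Points Ω) = 1) ∧
      (∀ a : O, ∀ P ∈ Kflat, (AlgPoints.map (act''.i a) P : A''.toAffine.toAbelianVariety.Points Ω) ∈ Kflat) ∧
      -- (V♭) the `𝔭′`-block of `K♭` is the image line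
      (∀ P'' : A''.toAffine.toAbelianVariety.Points Ω,
        (P'' ∈ Kflat ∧ ∀ a ∈ 𝔭', (AlgPoints.map (act''.i a) P'' : A''.toAffine.toAbelianVariety.Points Ω) = 1) ↔
          ((∀ a ∈ 𝔭', (AlgPoints.map (act''.i a) P'' : A''.toAffine.toAbelianVariety.Points Ω) = 1) ∧
            ∃ P : A.toAffine.toAbelianVariety.Points Ω, (∀ a ∈ 𝔭', (AlgPoints.map (act.i a) P : A.toAffine.toAbelianVariety.Points Ω) = 1) ∧
              (AlgPoints.map c P'' : B.toAffine.toAbelianVariety.Points Ω) = AlgPoints.map q P)) ∧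
      -- (W♭) the `𝔭`-block of `K♭` is `{x^p | c x ∈ q(A[𝔭])}`
      (∀ P'' : A''.toAffine.toAbelianVariety.Points Ω,
        (P'' ∈ Kflat ∧ ∀ a ∈ 𝔭, (AlgPoints.map (act''.i a) P'' : A''.toAffine.toAbelianVariety.Points Ω) = 1) ↔
          ∃ R : A.toAffine.toAbelianVariety.Points Ω, (∀ a ∈ 𝔭, (AlgPoints.map (act.i a) R : A.toAffine.toAbelianVariety.Points Ω) = 1) ∧
            ∃ x : A''.toAffine.toAbelianVariety.Points Ω,
              (AlgPoints.map c x : B.toAffine.toAbelianVariety.Points Ω) = AlgPoints.map q R ∧ P'' = x ^ p) ∧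
      -- (COUNT)
      Nat.card ↥Kflat = n * n := by
  classical
  haveI := act.isMonHom
  haveI := act''.isMonHom
  haveI : IsCommMonObj A.X := A.isCommMonObj_of_isReduced_base
  haveI : IsCommMonObj A''.X := A''.isCommMonObj_of_isReduced_base
  -- token-shape ↔ morphism-shape readers
  have hp𝔭𝔭' : (p : O) ∈ 𝔭 * 𝔭' := mem_mul_of_mem_of_mem_of_sup_eq_top h𝔭𝔭' hp𝔭 hp𝔭'
  have hKm : ∀ P : specOver Ω Ω ⟶ A.X, P ≫ q = 1 → ∀ a ∈ 𝔭 * 𝔭', P ≫ act.i a = 1 := fun P hP a ha => hK P ((h1 P).1 hP) a ha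
  have hkc : ∀ P : specOver Ω Ω ⟶ A''.X, (∀ a ∈ 𝔭, P ≫ act''.i a = 1) → P ≫ c = 1 := fun P hP => (h2 P).2 hP
  have hck : ∀ P : specOver Ω Ω ⟶ A''.X, P ≫ c = 1 → ∀ a ∈ 𝔭, P ≫ act''.i a = 1 := fun P hP => (h2 P).1 hP
  have hkq₀ : ∀ P : specOver Ω Ω ⟶ A.X, (∀ a ∈ 𝔭', P ≫ act.i a = 1) → P ≫ q₀ = 1 := fun P hP => (h1₀ P).2 hP
  have hq₀k : ∀ P : specOver Ω Ω ⟶ A.X, P ≫ q₀ = 1 → ∀ a ∈ 𝔭', P ≫ act.i a = 1 := fun P hP => (h1₀ P).1 hP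
  -- §1 of ★ A: the return hom `d′` of `q` (`Ker q ⊆ A[𝔭𝔭′] ⊆ A[p]`)
  have hqp : ∀ P : specOver Ω Ω ⟶ A.X, P ≫ q = 1 → P ^ p = 1 := fun P hP => by
    rw [← comp_i_natCast act P p]; exact hKm P hP _ hp𝔭𝔭'
  obtain ⟨d', hd', hqd', hd'q⟩ := exists_returnHom_quotient q hqp
  haveI := hd'
  have hequiv : ∀ a : O, act''.i a ≫ c ≫ d' = c ≫ d' ≫ act.i a := equivariant_cover_comp_returnHom act act'' q c d' hqd' h4
  -- §2: the leg `φ♭`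
  obtain ⟨φ, hφ, hφξ⟩ := exists_flatLeg act act'' q c q₀ hp 𝔭 𝔭' d' hd'q hKm hkc hkq₀ hequiv ε hε1 hε2
  haveI := hφ
  -- §3: the rows
  have hACT : ∀ a : O, ∃ b₀ : B₂.X ⟶ B₂.X, act.i a ≫ q₀ = q₀ ≫ b₀ ∧ act''.i a ≫ φ = φ ≫ b₀ := fun a => by
    obtain ⟨b₀, hbq₀, -⟩ := h4₀ a
    exact ⟨b₀, hbq₀, act_comp_flatLeg act act'' c q₀ hp d' hequiv φ hφξ a b₀ hbq₀⟩
  -- the kernel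
  let Φ : A''.toAffine.toAbelianVariety.Points Ω →* B₂.toAffine.toAbelianVariety.Points Ω := IsMonHom.monoidHom φ (specOver Ω Ω)
  have hΦ : ∀ P, P ∈ Φ.ker ↔ (P : specOver Ω Ω ⟶ A''.X) ≫ φ = 1 := fun P => Iff.rfl
  have htors : ∀ P ∈ Φ.ker, ∀ a ∈ 𝔭 * 𝔭', (AlgPoints.map (act''.i a) P : A''.toAffine.toAbelianVariety.Points Ω) = 1 :=
    fun P hP => (flatLeg_kernel_torsion_and_image act act'' q c q₀ hp 𝔭 𝔭' d' hd'q hck hq₀k h4 φ hφξ P ((hΦ P).1 hP)).1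
  have hst : ∀ a : O, ∀ P ∈ Φ.ker, (AlgPoints.map (act''.i a) P : A''.toAffine.toAbelianVariety.Points Ω) ∈ Φ.ker :=
    fun a P hP => (hΦ _).2 (comp_i_comp_flatLeg_eq_one act act'' q₀ φ hACT P ((hΦ P).1 hP) a)
  have hV : ∀ P'' : A''.toAffine.toAbelianVariety.Points Ω,
      (P'' ∈ Φ.ker ∧ ∀ a ∈ 𝔭', (AlgPoints.map (act''.i a) P'' : A''.toAffine.toAbelianVariety.Points Ω) = 1) ↔
        ((∀ a ∈ 𝔭', (AlgPoints.map (act''.i a) P'' : A''.toAffine.toAbelianVariety.Points Ω) = 1) ∧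
          ∃ P : A.toAffine.toAbelianVariety.Points Ω, (∀ a ∈ 𝔭', (AlgPoints.map (act.i a) P : A.toAffine.toAbelianVariety.Points Ω) = 1) ∧
            (AlgPoints.map c P'' : B.toAffine.toAbelianVariety.Points Ω) = AlgPoints.map q P) := by
    intro P''
    constructor
    · rintro ⟨hP, hP𝔭'⟩
      obtain ⟨R, hR, hcR⟩ := (flatLeg_kernel_torsion_and_image act act'' q c q₀ hp 𝔭 𝔭' d' hd'q hck hq₀k h4 φ hφξ P'' ((hΦ P'').1 hP)).2
      exact ⟨hP𝔭', R, hR, hcR⟩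
    · rintro ⟨hP𝔭', R, hR, hcR⟩
      exact ⟨(hΦ P'').2 (map_flatLeg_eq_one_of_image act act'' q c q₀ hp 𝔭 𝔭' hp𝔭' h𝔭'unr d' hqd' hd'q hKm hkc hkq₀ hequiv ε hε1 hε2 φ hφξ
        P'' hP𝔭' R hR hcR), hP𝔭'⟩
  have hWb : ∀ P'' : A''.toAffine.toAbelianVariety.Points Ω,
      (P'' ∈ Φ.ker ∧ ∀ a ∈ 𝔭, (AlgPoints.map (act''.i a) P'' : A''.toAffine.toAbelianVariety.Points Ω) = 1) ↔
        ∃ R : A.toAffine.toAbelianVariety.Points Ω, (∀ a ∈ 𝔭, (AlgPoints.map (act.i a) R : A.toAffine.toAbelianVariety.Points Ω) = 1) ∧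
          ∃ x : A''.toAffine.toAbelianVariety.Points Ω,
            (AlgPoints.map c x : B.toAffine.toAbelianVariety.Points Ω) = AlgPoints.map q R ∧ P'' = x ^ p := by
    intro P''
    constructor
    · rintro ⟨hP, hP𝔭⟩
      obtain ⟨R, hR, x, hxc, hPx⟩ := exists_pow_eq_of_map_flatLeg_eq_one act act'' q c q₀ hp 𝔭 𝔭' d' hqd' hkc hq₀k h4 hequiv ε hε1 hε2 hε3 φ hφξ
        P'' ((hΦ P'').1 hP) hP𝔭
      exact ⟨R, hR, x, hxc, hPx⟩
    · rintro ⟨R, hR, x, hxc, rfl⟩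
      obtain ⟨h₁, h₂⟩ := map_flatLeg_pow_eq_one act act'' q c q₀ 𝔭 hp𝔭 d' hqd' hck h4 φ hφξ R hR x hxc
      exact ⟨(hΦ _).2 h₁, h₂⟩
  -- the count: `#K♭ = #K♭[𝔭] · #K♭[𝔭′]`, `#K♭[𝔭′] = #L♯ = n`, `#K♭[𝔭] · #K_𝔭 = #A[𝔭] = n · n`
  have hsplit := RingAction.natCard_eq_mul_of_idealTorsion_mul act'' 𝔭 𝔭' h𝔭𝔭' Φ.ker htors hst
  have hcw : Nat.card {P : A''.toAffine.toAbelianVariety.Points Ω //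
      P ∈ Φ.ker ∧ ∀ b ∈ 𝔭', (AlgPoints.map (act''.i b) P : A''.toAffine.toAbelianVariety.Points Ω) = 1} = n := by
    rw [← hcardL]
    exact Nat.card_congr (Equiv.subtypeEquivRight fun P => (hV P).trans (hLsharp P).symm)
  haveI : Surjective c.left := ⟨h2s⟩
  have hwc := natCard_wBlock_mul_natCard_eq act act'' q c 𝔭 hp𝔭 ε hε1 hε2 K h1 h2 h2s h4
  rw [hA𝔭, hK𝔭] at hwc
  have hw : Nat.card {P : A''.toAffine.toAbelianVariety.Points Ω //
      P ∈ Φ.ker ∧ ∀ a ∈ 𝔭, (AlgPoints.map (act''.i a) P : A''.toAffine.toAbelianVariety.Points Ω) = 1} = n := by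
    rw [Nat.card_congr (Equiv.subtypeEquivRight hWb)]
    exact Nat.eq_of_mul_eq_mul_right hn hwc
  rw [hw, hcw] at hsplit
  exact ⟨φ, hφ, Φ.ker, fun P => (hΦ P).symm, flatLeg_similitude q c q₀ hp D pol D'' pol'' DB lamB hDB DB₂ lamB₂ hDB₂ d' hqd' hd'q h3 h3'' h3₀ φ hφξ,
    fun a => by
      obtain ⟨b₀, hbq₀, hbc₀⟩ := h4₀ a
      exact ⟨b₀, act_comp_flatLeg act act'' c q₀ hp d' hequiv φ hφξ a b₀ hbq₀, hbc₀⟩,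
    map_flatLeg_level q c q₀ d' hqd' c₀ φ hφξ σ σ'' σt h5 h5₀ hσ'' hσt m hm, htors, hst, hV, hWb, hsplit⟩

end AbelianSchemeOver

end Literature.AlgebraicGeometry.AbelianSchemes

end
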